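import Literature.MathematicalPhysics.QuantumFieldTheory.Balaban1983to89.B1TorusSubBoxOp
import Literature.MathematicalPhysics.QuantumFieldTheory.Balaban1983to89.B1TorusChainChart
import Literature.MathematicalPhysics.QuantumFieldTheory.Balaban1983to89.B4Lemma22HolderNoCollarContours

/-!
# `Balaban1983to89.B1TorusSubBoxHolderInput` — [Balaban1983RegularityDecay] LEMMA 2.2 (2.16), THE HÖLDER MEMBER, WITH **NO COLLAR**, ON A
# SUB-BOX `boxT j Mb` OF THE (Higgs)₂,₃ TORUS AT THE RAW REGULAR FIELD «Ã_j = A» — the per-piece Hölder input of the random walk for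
# [Balaban1982Higgs1] Prop. 2.1 (2.24) on rectangular parallelepipeds (p. 611 l.1–2 «without any restrictions on the points x, x′»)

statement-level skeleton of published theorems with citation tags; proofs where landed; nothing here is a claim about the Yang–Mills mass gap

PDF held: `paper:balaban1983-cmp89-regularity-decay` pp. 572–573, 575, 577–579 [PDF 2–3, 5, 7–9]; `paper:balaban1982-cmp85-higgs23-i`
pp. 608, 610–611 [PDF 6, 8–9].

CITATION HEADER (lean-in-tree rule).  T. Bałaban, *Regularity and decay of lattice Green's functions*, Commun. Math. Phys. **89** (1983)
571–597 [Balaban1983RegularityDecay] (Lemma 2.2 (2.16) p. 577 with (2.14); §2 p. 575 «if □_j intersects the boundary of Ω, then Ã_j = A»;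
p. 579 L25–28 «we can apply Lemma 2.2 to all operators in it, so the restriction dist({x, x′}, Ωᶜ) ≧ R₀ is unnecessary»; (1.4), (1.7)
p. 572; Theorem (1.9) p. 573) and T. Bałaban, *(Higgs)₂,₃ quantum fields in a finite volume. I*, Commun. Math. Phys. **85** (1982) 603–626
[Balaban1982Higgs1] ((2.2) p. 608; Prop. 2.1 (2.23)–(2.24) p. 610; p. 611 l.1–2).  Cell `lit-balaban` (HOME `run/shared/lean/pub/lit-balaban/`),
Phase-2 proof seat **p35** gen 21 (unit `lit-balaban-p35`); SKELETON rows **B4.Lem2.2** ((2.16) carrier instance, no collar) and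
**B1.Prop2.1** / **B1.Eq2.24** (parallelepiped clause: the per-piece Hölder letter).  USED BY NAME, never restated: this seat's gen-21
`B4Lemma22HolderNoCollarContours.lemma22_holder_noCollar_contour` (the generic member for any contour system), gen 15's sub-box chart
`B1TorusSubBoxChart.{boxT, pullB, gammaB, gammaB_nn, gammaB_hend, length_gammaB_le_real, add_e1_mem_boxB_iff, toT_mem_boxT, boxT_subset_cube,
box_subset_M2, supN_pullB_le, fld_pullB_ofLp}` and `B1TorusSubBoxOp.{bondB, bondB_fwd, bondB_bwd, pullB_propagatorK, smul_ofLp_covDeriv_toT_sub}`,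
gen 10's chains `B1TorusChainTransport.{IsTChain, TNbr, hol, bondVal, bondVal_shift, bondVal_of_shift}` and `B1TorusChainChart.{fromT_shift,
supNorm_pathEnd_sub_le, tdist_le_supNorm_fromT}`, `B4Lemma22HolderBox.{pathSum, IsNNChain, transport_fieldLink}`, `B4Lemma22HolderCubeField.holder_threshold`
(not used: thresholds come with the generic member), `B4CubeFieldHyps22.aSeq_window`.

WHAT IS PRINTED.  [B4] p. 577 Lemma 2.2: «‖G_k(□,Ã)f‖_{1,α} ≤ c₁‖f‖_∞ (2.16)»; p. 575 [PDF 5] L22–24, verbatim: «where the configurations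
Ã_j are constructed in the following way: if □_j intersects the boundary of Ω, then Ã_j = A; …»; p. 579 [PDF 9] L25–28, verbatim: «Finally
let us notice that if Ω is a rectangular parallelepiped, then all □_j in the representation (2.13) are cubes and we can apply Lemma 2.2 to
all operators in it, so the restriction dist({x, x′}, Ωᶜ) ≧ R₀ is unnecessary.»  [B1] p. 611 [PDF 9] l.1–2, verbatim: «For some simple sets
Ω, e.g. for rectangular parallelepipeds, the inequalities hold without any restrictions on the points x, x′.»

WHAT THIS MODULE PROVES (theorems only; no `def`, no `Prop` fact, no `sorry`; axioms standard).
* §1 the chain dictionary on a sub-box (gen 10's `B1TorusChainChart` for `boxT j Mb` and the raw field): `exists_liftB`, `lift_stepB`,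
  `isNNChain_liftB`, `toT_pathEnd_liftB`, `pathSum_liftB` (`κ·Σ bondB = εe·A(Γ)`), `transport_liftB`, `ofLp_holB` (`U(A(Γ)) ↔ transport`).
* §2 **`subbox_input_holder`** — LEMMA 2.2 (2.16), HÖLDER MEMBER, NO COLLAR, ON A SUB-BOX OF THE TORUS AT «Ã_j = A»: constants `C_H > 0`
  (for `0 ≤ α < 1`), then for `(c, β)` and `K₀ ≥ 8` a threshold `e₁ > 0`, such that on every admissible instance (`K ≥ 1`, `K ≤ K_P`,
  `K₀ ∣ M_P`, `3M ≤ |T_ε|_μ`, `a ∈ [a₋,a₊]`, `m² > 0`, `m²(L^Kε)² ≤ m²₊`), every chart label `j` and sides `Mb` (`1 ≤ Mb_i ≤ 2K₀`, `K₀ ∣ Mb_i`),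
  ANY vector field `A` whose scaled components are (1.7)-regular on the sub-box at the effective charge `0 < e_c ≤ e₁`: for every source `φ`,
  direction `μ`, sites `x ≠ x′` with `x, x+εe_μ, x′, x′+εe_μ ∈ boxT`, every nearest-neighbour chain `Γ ⊂ boxT` from `x` to `x′` with
  `|Γ| ≤ d|x − x′|`: `‖U(A(Γ))(D^ε_AG(φ))(⟨x′,μ⟩) − (D^ε_AG(φ))(⟨x,μ⟩)‖ ≤ C_H(|x − x′|/L^K)^α(L^Kε)‖φ‖_∞`, `G = G^ε_K(boxT, A)`.
HONEST SCOPE.  (i) The sub-boxes, chart, contours and field dictionary are gen 15's (`B1TorusSubBoxChart`/`B1TorusSubBoxOp`); the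
generic Hölder member is r04 g15's no-collar Lemma 2.2 made contour-generic (this seat's `B4Lemma22HolderNoCollarContours`); (ii) the
regularity hypothesis is the chart form of (2.23) on the sites of the sub-box (the carrier form is converted by
`B1Ineq225RegularBox.abs_acT_sub_le_of_reg_on_boxT`); (iii) constants existential, explicit in the proof.  The consumer (the (2.24) Hölder
member on cell-product boxes without `R₀`) is `B1Ineq224RegularBox`.  Unit `lit-balaban-p35` gen 21 (literature-prover-lit-balaban-p35-g21-0).
-/

open scoped BigOperators Matrix

noncomputable section

namespace Literature.MathematicalPhysics.QuantumFieldTheory.Balaban1983to89.B1TorusSubBoxHolderInput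

open Literature.MathematicalPhysics.QuantumFieldTheory.Balaban1983to89.HiggsLattice
open Literature.MathematicalPhysics.QuantumFieldTheory.Balaban1983to89.HiggsCovariance
open Literature.MathematicalPhysics.QuantumFieldTheory.Balaban1983to89.HiggsCovariancePos (shift_unshift unshift_shift)
open Literature.MathematicalPhysics.QuantumFieldTheory.Balaban1983to89.B1TorusCubeCover
open Literature.MathematicalPhysics.QuantumFieldTheory.Balaban1983to89.B1TorusCubeChart
open Literature.MathematicalPhysics.QuantumFieldTheory.Balaban1983to89.B1TorusCubeContours
open Literature.MathematicalPhysics.QuantumFieldTheory.Balaban1983to89.B1TorusCubeBoxOp (flowC ellC ellC_nonneg flowC_lipschitz ofLp_U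
  acT two_le_half)
open Literature.MathematicalPhysics.QuantumFieldTheory.Balaban1983to89.B1TorusSubBoxChart
open Literature.MathematicalPhysics.QuantumFieldTheory.Balaban1983to89.B1TorusSubBoxOp (bondB bondB_fwd bondB_bwd pullB_propagatorK
  smul_ofLp_covDeriv_toT_sub)
open Literature.MathematicalPhysics.QuantumFieldTheory.Balaban1983to89.B4GaugeCovariance
open Literature.MathematicalPhysics.QuantumFieldTheory.Balaban1983to89.B4Reflection242 (boxDom mem_boxDom nbrs mem_nbrs nbrs_comm)
open Literature.MathematicalPhysics.QuantumFieldTheory.Balaban1983to89.B4Lower18Regular (e1 e1_apply_self e1_apply_ne PathRel baseEmb)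
open Literature.MathematicalPhysics.QuantumFieldTheory.Balaban1983to89.B4Lower18RegularRegion (compField)
open Literature.MathematicalPhysics.QuantumFieldTheory.Balaban1983to89.B4Lemma21Region (siteNorm)
open Literature.MathematicalPhysics.QuantumFieldTheory.Balaban1983to89.B4ContourShift (supNorm supNorm_nonneg abs_le_supNorm)
open Literature.MathematicalPhysics.QuantumFieldTheory.Balaban1983to89.B4Lemma22Reduce231 (supN le_supN supN_le supN_nonneg
  siteNorm_nonneg siteNorm_smul)
open Literature.MathematicalPhysics.QuantumFieldTheory.Balaban1983to89.B4Lemma22ReduceZero (Box greenA derivA)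
open Literature.MathematicalPhysics.QuantumFieldTheory.Balaban1983to89.B4Lemma22ReduceDeriv (add_e1_mem_nbrs)
open Literature.MathematicalPhysics.QuantumFieldTheory.Balaban1983to89.B4CubeFieldHyps22 (aSeq_window)
open Literature.MathematicalPhysics.QuantumFieldTheory.Balaban1983to89.B4Lemma22HolderBox (pathSum IsNNChain transport_fieldLink)
open Literature.MathematicalPhysics.QuantumFieldTheory.Balaban1983to89.B4Lemma22HolderNoCollarContours (lemma22_holder_noCollar_contour)
open Literature.MathematicalPhysics.QuantumFieldTheory.Balaban1983to89.B1TorusChainTransport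
open Literature.MathematicalPhysics.QuantumFieldTheory.Balaban1983to89.B1TorusChainChart (fromT_shift supNorm_pathEnd_sub_le
  tdist_le_supNorm_fromT)

variable {P : HiggsLattice.Params} {N : ℕ}

/-- `K₀ ≥ 8 ⇒ K₀ ≥ 1`. [folklore] -/
private theorem one_le_of_eight_le {K₀ : ℕ} (hK₀8 : 8 ≤ K₀) : 1 ≤ K₀ := le_trans (by norm_num) hK₀8

/-- The Euclidean site norm of the coordinate vector of `v ∈ ℝ^N` is `‖v‖`. [folklore] -/
private theorem siteNorm_ofLp (v : EuclideanSpace ℝ (Fin N)) : siteNorm (WithLp.ofLp v) = ‖v‖ := by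
  rw [siteNorm, EuclideanSpace.norm_eq]
  congr 1
  simp only [dotProduct, Real.norm_eq_abs, sq, abs_mul_abs_self]

/-- distinct integer vectors are at sup-distance at least `1`. [folklore] -/
private theorem one_le_supNorm_of_ne' {d : ℕ} {z z' : Fin (d + 1) → ℤ} (h : z' ≠ z) : 1 ≤ supNorm (z' - z) := by
  obtain ⟨i, hi⟩ : ∃ i, z' i ≠ z i := by
    by_contra hc
    push Not at hc
    exact h (funext hc)
  have h1 : (1 : ℤ) ≤ |(z' - z) i| := by
    rw [Pi.sub_apply]
    exact Int.one_le_abs (sub_ne_zero.mpr hi)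
  have h1' : (1 : ℝ) ≤ ((|(z' - z) i| : ℤ) : ℝ) := by exact_mod_cast h1
  exact h1'.trans (abs_le_supNorm _ _)

/-! ## §1 Chains of a sub-box `boxT j Mb` under the chart: `IsNNChain`, `pathSum`, `transport` (gen 10's dictionary, sub-box form) -/

section Chart

variable {K K₀ : ℕ}

/-- A chain of sites of the sub-box is the image under the chart of a list of sub-box points. [cite: Balaban1983RegularityDecay, §2 p.575] -/
theorem exists_liftB (j : Lab P K K₀) (Mb : Fin (dd P + 1) → ℕ) (l : List (HiggsLattice.Site P 0))
    (hl : ∀ y ∈ l, y ∈ boxT K K₀ j Mb) :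
    ∃ lB : List ↥(Box (dd P) (P.L - 1) K Mb), lB.map (fun z => toT K K₀ j z.1) = l := by
  induction l with
  | nil => exact ⟨[], rfl⟩
  | cons y l ih =>
      obtain ⟨lB, hlB⟩ := ih (fun z hz => hl z (List.mem_cons_of_mem _ hz))
      refine ⟨⟨fromT K K₀ j y, mem_boxT_iff.1 (hl y (by simp))⟩ :: lB, ?_⟩
      simp [toT_fromT, hlB]

/-- ONE STEP OF A LIFTED CHAIN ON THE SUB-BOX: if `toT z = x`, `toT z′ = y` (sub-box points) and `x`, `y` are torus neighbours, then
either `y = x + εe_{castD i}`, `z′ = z + e_i`, or `x = y + εe_{castD i}`, `z = z′ + e_i`. [cite: Balaban1983RegularityDecay, §2 p.575] -/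
theorem lift_stepB (hK : K ≤ P.K) (hK₀ : K₀ ∣ P.M) (hK₀8 : 8 ≤ K₀) (hN3 : ∀ μ, 3 * half P K K₀ ≤ P.sitesPerDir 0 μ)
    (j : Lab P K K₀) {Mb : Fin (dd P + 1) → ℕ} (hMb : ∀ i, Mb i ≤ 2 * K₀)
    {z z' : ↥(Box (dd P) (P.L - 1) K Mb)} {x y : HiggsLattice.Site P 0}
    (hz : toT K K₀ j z.1 = x) (hz' : toT K K₀ j z'.1 = y) (hxy : TNbr x y) :
    (∃ i, y = x.shift (castD P i) ∧ z'.1 = z.1 + e1 i) ∨ (∃ i, x = y.shift (castD P i) ∧ z.1 = z'.1 + e1 i) := by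
  have hK₀' := one_le_of_eight_le hK₀8
  have hh2 : 2 ≤ half P K K₀ := two_le_half hK₀8
  have hsub := boxT_subset_cube hK hK₀ hK₀8 j hMb
  have hxc : x ∈ cube K K₀ j := by rw [← hz]; exact hsub (toT_mem_boxT hK hK₀ hK₀8 j hMb z.2)
  have hyc : y ∈ cube K K₀ j := by rw [← hz']; exact hsub (toT_mem_boxT hK hK₀ hK₀8 j hMb z'.2)
  have hfx : fromT K K₀ j x = z.1 := by rw [← hz, fromT_toT_of_mem hK hK₀ hK₀' j (box_subset_M2 hMb z.2)]
  have hfy : fromT K K₀ j y = z'.1 := by rw [← hz', fromT_toT_of_mem hK hK₀ hK₀' j (box_subset_M2 hMb z'.2)]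
  obtain ⟨μ, h | h⟩ := hxy
  · refine Or.inl ⟨(castD P).symm μ, by rw [Equiv.apply_symm_apply]; exact h, ?_⟩
    rw [← hfy, ← hfx, h]
    exact fromT_shift hK hK₀ hK₀' hN3 hh2 j hxc μ (h ▸ hyc)
  · refine Or.inr ⟨(castD P).symm μ, by rw [Equiv.apply_symm_apply]; exact h, ?_⟩
    rw [← hfy, ← hfx, h]
    exact fromT_shift hK hK₀ hK₀' hN3 hh2 j hyc μ (h ▸ hxc)

/-- **The lift of a contour of the sub-box is a nearest-neighbour chain of the box.** [cite: Balaban1983RegularityDecay, §2 p.575, (1.9) p.573] -/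
theorem isNNChain_liftB (hK : K ≤ P.K) (hK₀ : K₀ ∣ P.M) (hK₀8 : 8 ≤ K₀) (hN3 : ∀ μ, 3 * half P K K₀ ≤ P.sitesPerDir 0 μ)
    (j : Lab P K K₀) {Mb : Fin (dd P + 1) → ℕ} (hMb : ∀ i, Mb i ≤ 2 * K₀) :
    ∀ (lB : List ↥(Box (dd P) (P.L - 1) K Mb)) (z : ↥(Box (dd P) (P.L - 1) K Mb)) (x : HiggsLattice.Site P 0),
      toT K K₀ j z.1 = x → IsTChain x (lB.map fun w => toT K K₀ j w.1) → IsNNChain z lB := by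
  intro lB
  induction lB with
  | nil => intro z x _ _; exact trivial
  | cons w lB ih =>
      intro z x hz hch
      obtain ⟨hxy, hrest⟩ := hch
      refine ⟨?_, ih w _ rfl hrest⟩
      rcases lift_stepB hK hK₀ hK₀8 hN3 j hMb hz rfl hxy with ⟨i, -, e⟩ | ⟨i, -, e⟩
      · rw [e]; exact add_e1_mem_nbrs _ _
      · rw [nbrs_comm, e]; exact add_e1_mem_nbrs _ _

/-- The chart carries end points to end points. [cite: Balaban1983RegularityDecay, §2 p.575] -/
theorem toT_pathEnd_liftB (j : Lab P K K₀) (Mb : Fin (dd P + 1) → ℕ) :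
    ∀ (lB : List ↥(Box (dd P) (P.L - 1) K Mb)) (z : ↥(Box (dd P) (P.L - 1) K Mb)),
      toT K K₀ j (pathEnd z lB).1 = pathEnd (toT K K₀ j z.1) (lB.map fun w => toT K K₀ j w.1) := by
  intro lB
  induction lB with
  | nil => intro z; rfl
  | cons w lB ih => intro z; exact ih w

/-- **«A(Γ) = Σ_{b⊂Γ} A_b» UNDER THE SUB-BOX CHART, RAW FIELD**: along a contour of `boxT`, `κ·Σ_{steps} bondB = εe·A(Γ)` when `κσ = εe`.
[cite: Balaban1983RegularityDecay, p.572, p.576, §2 p.575] -/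
theorem pathSum_liftB (C : ChargeData N) (hK : K ≤ P.K) (hK₀ : K₀ ∣ P.M) (hK₀8 : 8 ≤ K₀)
    (hN3 : ∀ μ, 3 * half P K K₀ ≤ P.sitesPerDir 0 μ) (hS : ∀ μ, 2 < P.sitesPerDir 0 μ) (j : Lab P K K₀)
    {Mb : Fin (dd P + 1) → ℕ} (hMb : ∀ i, Mb i ≤ 2 * K₀) {κ σ : ℝ} (hκσ : κ * σ = P.mesh 0 * C.e)
    (A : HiggsLattice.VecField P 0) :
    ∀ (lB : List ↥(Box (dd P) (P.L - 1) K Mb)) (z : ↥(Box (dd P) (P.L - 1) K Mb)) (x : HiggsLattice.Site P 0),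
      toT K K₀ j z.1 = x → IsTChain x (lB.map fun w => toT K K₀ j w.1) →
        κ * pathSum (bondB K K₀ j Mb σ A) z lB = P.mesh 0 * C.e * pathSum (bondVal A) x (lB.map fun w => toT K K₀ j w.1) := by
  intro lB
  induction lB with
  | nil => intro z x _ _; simp [pathSum]
  | cons w lB ih =>
      intro z x hz hch
      obtain ⟨hxy, hrest⟩ := hch
      simp only [List.map_cons, pathSum, mul_add]
      rw [ih w _ rfl hrest]
      congr 1
      rcases lift_stepB hK hK₀ hK₀8 hN3 j hMb hz rfl hxy with ⟨i, e, hw⟩ | ⟨i, e, hw⟩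
      · rw [bondB_fwd j Mb C hκσ A hw, hz, e, bondVal_shift hS]
      · rw [bondB_bwd j Mb C hκσ A hw, e, bondVal_of_shift hS, mul_neg]

/-- **`U(A(Γ))` UNDER THE SUB-BOX CHART is the lineage's `transport` along the lifted chain.**
[cite: Balaban1983RegularityDecay, (1.4) p.572] [cite: Balaban1982Higgs1, (1.7) p.605] -/
theorem transport_liftB (C : ChargeData N) (hK : K ≤ P.K) (hK₀ : K₀ ∣ P.M) (hK₀8 : 8 ≤ K₀)
    (hN3 : ∀ μ, 3 * half P K K₀ ≤ P.sitesPerDir 0 μ) (hS : ∀ μ, 2 < P.sitesPerDir 0 μ) (j : Lab P K K₀)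
    {Mb : Fin (dd P + 1) → ℕ} (hMb : ∀ i, Mb i ≤ 2 * K₀) {κ σ : ℝ} (hκσ : κ * σ = P.mesh 0 * C.e)
    (A : HiggsLattice.VecField P 0) (lB : List ↥(Box (dd P) (P.L - 1) K Mb)) (z : ↥(Box (dd P) (P.L - 1) K Mb))
    {x : HiggsLattice.Site P 0} (hz : toT K K₀ j z.1 = x) (hch : IsTChain x (lB.map fun w => toT K K₀ j w.1)) :
    transport (fieldLink (flowC C) κ (bondB K K₀ j Mb σ A)) z lB
      = (flowC C).U (P.mesh 0 * C.e * pathSum (bondVal A) x (lB.map fun w => toT K K₀ j w.1)) := by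
  rw [transport_fieldLink, pathSum_liftB C hK hK₀ hK₀8 hN3 hS j hMb hκσ A lB z x hz hch]

/-- **`U(A(Γ))v` ON COORDINATES `= transport · v`** (sub-box chart, raw field). [cite: Balaban1983RegularityDecay, (1.4) p.572, (1.9) p.573] -/
theorem ofLp_holB (C : ChargeData N) (hK : K ≤ P.K) (hK₀ : K₀ ∣ P.M) (hK₀8 : 8 ≤ K₀)
    (hN3 : ∀ μ, 3 * half P K K₀ ≤ P.sitesPerDir 0 μ) (hS : ∀ μ, 2 < P.sitesPerDir 0 μ) (j : Lab P K K₀)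
    {Mb : Fin (dd P + 1) → ℕ} (hMb : ∀ i, Mb i ≤ 2 * K₀) {κ σ : ℝ} (hκσ : κ * σ = P.mesh 0 * C.e)
    (A : HiggsLattice.VecField P 0) (lB : List ↥(Box (dd P) (P.L - 1) K Mb)) (z : ↥(Box (dd P) (P.L - 1) K Mb))
    {x : HiggsLattice.Site P 0} (hz : toT K K₀ j z.1 = x) (hch : IsTChain x (lB.map fun w => toT K K₀ j w.1))
    (v : EuclideanSpace ℝ (Fin N)) :
    WithLp.ofLp (hol C A x (lB.map fun w => toT K K₀ j w.1) v)
      = transport (fieldLink (flowC C) κ (bondB K K₀ j Mb σ A)) z lB *ᵥ WithLp.ofLp v := by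
  rw [transport_liftB C hK hK₀ hK₀8 hN3 hS j hMb hκσ A lB z hz hch]
  unfold hol
  rw [ofLp_U]

end Chart

/-! ## §2 Lemma 2.2 (2.16), the Hölder member, no collar, on a sub-box of the torus at «Ã_j = A» -/

section Inputs

variable {K K₀ : ℕ}

set_option maxHeartbeats 1600000 in
/-- **LEMMA 2.2 (2.16), HÖLDER MEMBER, WITH NO COLLAR, ON A SUB-BOX OF THE (Higgs)₂,₃ TORUS AT THE RAW FIELD «Ã_j = A»** (p. 579 «we can apply
Lemma 2.2 to all operators in it»).  QUANTIFIER ORDER: for `0 ≤ α < 1` a constant `C_H > 0` (from the contour-generic no-collar member at the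
model's flow); then for the regularity pair `(creg, β)` and the window size `K₀ ≥ 8` a threshold `e₁`; then the instance: the torus (`K ≥ 1`,
`K ≤ K_P`, `K₀ ∣ M_P`, `3M ≤ |T_ε|`), `a ∈ [a₋, a₊]`, `m² > 0` with `m²(L^Kε)² ≤ m²₊`, the chart label `j` and sides `Mb` (`1 ≤ Mb_i ≤ 2K₀`,
`K₀ ∣ Mb_i`), ANY vector field `A` on `T_ε` whose scaled components `acT` (scale `σ = L^Kε·e/e_c`) are (1.7)-regular on the sub-box, and the
effective charge `0 < e_c ≤ e₁`.  CONCLUSION, for every source `φ`, direction `μ`, sites `x ≠ x′` with `x, x + εe_μ, x′, x′ + εe_μ ∈ boxT`, every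
nearest-neighbour chain `Γ ⊂ boxT` from `x` to `x′` with `|Γ| ≤ d|x − x′|`:
`‖U(A(Γ))(D^ε_A G(φ))(⟨x′,μ⟩) − (D^ε_A G(φ))(⟨x,μ⟩)‖ ≤ C_H(|x − x′|/L^K)^α(L^Kε)‖φ‖_∞`, `G = G^ε_K(boxT, A)` — the third member of (2.14) in the
model's units.  Proof = gen 10's `cube_input_holder` on the sub-box chart: `lemma22_holder_noCollar_contour` at the contour system `gammaB`, the
dictionary `pullB G = (L^Kε)²·greenA·pullB`, `(L^Kε)·D^ε ↔ derivA`, `U(A(Γ)) ↔ transport` (§1).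
[cite: Balaban1983RegularityDecay, Lemma 2.2 (2.16) p.577 with (2.14) p.577, §2 p.575 (Ã_j = A), p.579 L25–28, (1.9) p.573]
[cite: Balaban1982Higgs1, Prop. 2.1 (2.23)–(2.24) p.610, p.611 l.1–2] -/
theorem subbox_input_holder (C : ChargeData N) (d0 ℓ0 : ℕ) (hℓ0 : 1 ≤ ℓ0) (amin aplus m2plus : ℝ) (ha : 0 < amin)
    {α : ℝ} (hα0 : 0 ≤ α) (hα1 : α < 1) :
    ∃ CH : ℝ, 0 < CH ∧ ∀ (creg β : ℝ), 0 ≤ creg → 0 < β → ∀ (K₀ : ℕ), 8 ≤ K₀ →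
      ∃ e₁ : ℝ, 0 < e₁ ∧ ∀ (P : HiggsLattice.Params), dd P = d0 → P.L - 1 = ℓ0 →
        ∀ (K : ℕ), 1 ≤ K → K ≤ P.K → K₀ ∣ P.M → (∀ μ, 3 * half P K K₀ ≤ P.sitesPerDir 0 μ) →
        ∀ (a msq : ℝ), amin ≤ a → a ≤ aplus → 0 < msq → msq * P.mesh K ^ 2 ≤ m2plus →
        ∀ (j : Lab P K K₀) (Mb : Fin (dd P + 1) → ℕ), (∀ i, 1 ≤ Mb i) → (∀ i, Mb i ≤ 2 * K₀) → (∀ i, K₀ ∣ Mb i) →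
        ∀ (A : HiggsLattice.VecField P 0) (ec : ℝ), 0 < ec → ec ≤ e₁ →
          (∀ y ∈ Box (dd P) (P.L - 1) K Mb, ∀ i i' : Fin (dd P + 1),
            |acT K K₀ j ((((P.L - 1 + 1) ^ K : ℕ) : ℝ) * P.mesh 0 * C.e / ec) A (y + e1 i) i'
              - acT K K₀ j ((((P.L - 1 + 1) ^ K : ℕ) : ℝ) * P.mesh 0 * C.e / ec) A y i'|
              ≤ creg * ec ^ (β - 1) / ((P.L - 1 + 1) ^ K : ℕ)) →
          ∀ (φ : HiggsLattice.ScalarField P 0 N) (μ : Fin P.d) (x x' : HiggsLattice.Site P 0) (l : List (HiggsLattice.Site P 0)),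
            x ∈ boxT K K₀ j Mb → x.shift μ ∈ boxT K K₀ j Mb → x' ∈ boxT K K₀ j Mb → x'.shift μ ∈ boxT K K₀ j Mb → x' ≠ x →
            IsTChain x l → pathEnd x l = x' → (∀ y ∈ l, y ∈ boxT K K₀ j Mb) →
            (l.length : ℝ) ≤ (P.d : ℝ) * HiggsLattice.Site.tdist x x' →
            ‖hol C A x l (covDeriv C A (propagatorK C (boxT K K₀ j Mb) A msq a K φ) ⟨x', μ⟩)
                - covDeriv C A (propagatorK C (boxT K K₀ j Mb) A msq a K φ) ⟨x, μ⟩‖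
              ≤ CH * ((HiggsLattice.Site.tdist x x' : ℝ) / (P.L : ℝ) ^ K) ^ α * P.mesh K * ‖φ‖ := by
  classical
  obtain ⟨C₁, hC₁, hL⟩ := lemma22_holder_noCollar_contour (flowC C) (ellC_nonneg C) (flowC_lipschitz C) d0 ℓ0 hℓ0 amin aplus
    m2plus ha α hα0 hα1
  by_cases hapl : aplus < amin
  · refine ⟨1, one_pos, fun creg β _ _ K₀ _ => ⟨1, one_pos, ?_⟩⟩
    intro P _ _ K _ _ _ _ a msq e1' e2
    exact absurd (e1'.trans e2) (not_le.2 hapl)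
  rw [not_lt] at hapl
  set CH : ℝ := C₁ * ((d0 : ℝ) + 1) with hCH_def
  have hCH0 : 0 < CH := by positivity
  refine ⟨CH, hCH0, fun creg β hcreg hβ K₀ hK₀8 => ?_⟩
  obtain ⟨e₁, he₁, hth⟩ := hL creg β hcreg hβ (2 * K₀)
  refine ⟨e₁, he₁, ?_⟩
  intro P hd hl K hK1 hK hK₀ hN3 a msq e1' e2 hmsq e4 j Mb hMb1 hMb hKM A ec hec hle h17
  subst hd; subst hl
  -- the instance
  have hK₀' : 1 ≤ K₀ := one_le_of_eight_le hK₀8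
  have hℓ : 1 ≤ P.L - 1 := hℓ0
  have hL2 : 2 ≤ P.L := by omega
  have hn : 1 ≤ (P.L - 1 + 1) ^ K := one_le_n P K
  have hn2 : 2 ≤ (P.L - 1 + 1) ^ K := by
    calc 2 ≤ P.L - 1 + 1 := by omega
      _ = (P.L - 1 + 1) ^ 1 := (pow_one _).symm
      _ ≤ (P.L - 1 + 1) ^ K := Nat.pow_le_pow_right (by omega) hK1
  have hnK3 : 3 ≤ (P.L - 1 + 1) ^ K * K₀ := by nlinarith
  have hnr : (0 : ℝ) < (((P.L - 1 + 1) ^ K : ℕ) : ℝ) := by exact_mod_cast hn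
  have hnR : ((((P.L - 1 + 1) ^ K : ℕ)) : ℝ) = (P.L : ℝ) ^ K := by rw [predL_succ, Nat.cast_pow]
  have hN3' : ∀ i, 3 ≤ (P.L - 1 + 1) ^ K * Mb i := fun i =>
    hnK3.trans (Nat.mul_le_mul_left _ (Nat.le_of_dvd (hMb1 i) (hKM i)))
  have ha' : 0 < a := lt_of_lt_of_le ha e1'
  have hm2 : 0 ≤ msq * P.mesh K ^ 2 := by positivity
  have hmeshK : 0 < P.mesh K := P.mesh_pos K
  have hh2 : 2 ≤ half P K K₀ := two_le_half hK₀8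
  have hS3 : ∀ μ', 2 < P.sitesPerDir 0 μ' := fun μ' => by
    have := hN3 μ'; have : 1 ≤ half P K K₀ := le_trans (by norm_num) hh2; omega
  -- the scaled field and the coupling `κ = e_c/n`, `κσ = εe`
  set σ : ℝ := (((P.L - 1 + 1) ^ K : ℕ) : ℝ) * P.mesh 0 * C.e / ec with hσ
  have hκσ : ec / (((P.L - 1 + 1) ^ K : ℕ) : ℝ) * σ = P.mesh 0 * C.e := by
    rw [hσ]; field_simp
  have hb : bondB K K₀ j Mb σ A = fun u v => compField (acT K K₀ j σ A) u.1 v.1 := rfl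
  -- the contour-system facts
  have hlen : ∀ (y : ↥(boxDom Mb)) (x : ↥(Box (dd P) (P.L - 1) K Mb)),
      ((gammaB P K Mb y x).length : ℝ) ≤ ((dd P : ℝ) + 1) * ((((P.L - 1 + 1) ^ K : ℕ)) : ℝ) :=
    fun y x => length_gammaB_le_real y x
  have hmem := hth K hK1 hn a _ e1' e2 hm2 e4 Mb hMb1 hMb hN3' (gammaB P K Mb) (fun y x => gammaB_nn y x)
    (fun y x hw => gammaB_hend y x hw) hlen (acT K K₀ j σ A) ec hec hle h17
  -- the torus data: source, chain, lift, box points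
  intro φ μ x x' l hxc hsc hx'c hs'c hne hch hend hlc hlen'
  set Φ := pullB K K₀ j Mb φ with hΦ
  set u := propagatorK C (boxT K K₀ j Mb) A msq a K φ with hu_def
  have hu : pullB K K₀ j Mb u = P.mesh K ^ 2 • (greenA (dd P) (flowC C) (ec / (((P.L - 1 + 1) ^ K : ℕ) : ℝ)) (P.L - 1) K a
      (msq * P.mesh K ^ 2) Mb (baseEmb (one_le_n P K) Mb) (gammaB P K Mb) (bondB K K₀ j Mb σ A) *ᵥ Φ) := by
    rw [hu_def, pullB_propagatorK C hK hK1 hK₀ hK₀8 hN3 hL2 j hMb hκσ ha' hmsq A]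
  set z : Fin (dd P + 1) → ℤ := fromT K K₀ j x with hz_def
  have hz : z ∈ Box (dd P) (P.L - 1) K Mb := mem_boxT_iff.1 hxc
  have hxz : toT K K₀ j z = x := toT_fromT j x
  set z' : Fin (dd P + 1) → ℤ := fromT K K₀ j x' with hz'_def
  have hz' : z' ∈ Box (dd P) (P.L - 1) K Mb := mem_boxT_iff.1 hx'c
  have hxz' : toT K K₀ j z' = x' := toT_fromT j x'
  set i : Fin (dd P + 1) := (castD P).symm μ with hi_def
  have hμ : castD P i = μ := Equiv.apply_symm_apply _ _
  have hze : z + e1 i ∈ Box (dd P) (P.L - 1) K Mb :=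
    (add_e1_mem_boxB_iff hK hK₀ hK₀8 hN3 j hMb hz i).2 (by rw [hxz, hμ]; exact hsc)
  have hze' : z' + e1 i ∈ Box (dd P) (P.L - 1) K Mb :=
    (add_e1_mem_boxB_iff hK hK₀ hK₀8 hN3 j hMb hz' i).2 (by rw [hxz', hμ]; exact hs'c)
  have hneB : z' ≠ z := fun e => hne (by rw [← hxz', ← hxz, e])
  -- the lift of the chain
  obtain ⟨lB, hlB⟩ := exists_liftB j Mb l hlc
  have hchB : IsTChain x (lB.map fun w => toT K K₀ j w.1) := by rw [hlB]; exact hch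
  have hNN : IsNNChain (⟨z, hz⟩ : ↥(Box (dd P) (P.L - 1) K Mb)) lB :=
    isNNChain_liftB hK hK₀ hK₀8 hN3 j hMb lB ⟨z, hz⟩ x hxz hchB
  have hlendB : pathEnd (⟨z, hz⟩ : ↥(Box (dd P) (P.L - 1) K Mb)) lB = ⟨z', hz'⟩ := by
    apply Subtype.ext
    have h1 := toT_pathEnd_liftB (K := K) (K₀ := K₀) j Mb lB ⟨z, hz⟩
    simp only at h1
    rw [hxz, hlB, hend] at h1
    have h2 := congrArg (fromT K K₀ j) h1
    rw [fromT_toT_of_mem hK hK₀ hK₀' j (box_subset_M2 hMb (pathEnd (⟨z, hz⟩ : ↥(Box (dd P) (P.L - 1) K Mb)) lB).2)] at h2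
    exact h2
  have hlenB' : (lB.length : ℝ) = l.length := by rw [← hlB, List.length_map]
  have htd : (HiggsLattice.Site.tdist x x' : ℝ) ≤ supNorm (z' - z) := tdist_le_supNorm_fromT j x x'
  have hd1 : ((dd P : ℝ) + 1) = (P.d : ℝ) := by rw [← dd_succ P]; push_cast; ring
  have hlenB : (lB.length : ℝ) ≤ ((dd P : ℝ) + 1) * supNorm (z' - z) := by
    rw [hlenB', hd1]
    exact hlen'.trans (mul_le_mul_of_nonneg_left htd (Nat.cast_nonneg _))
  have hsN1 : 1 ≤ supNorm (z' - z) := one_le_supNorm_of_ne' hneB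
  have hsN0 : 0 < supNorm (z' - z) := lt_of_lt_of_le one_pos hsN1
  -- Lemma 2.2 (2.16), no collar, generic contour system, at the scaled raw field
  have boxH := hmem i ⟨z, hz⟩ ⟨z + e1 i, hze⟩ ⟨z', hz'⟩ ⟨z' + e1 i, hze'⟩ rfl rfl hneB lB hNN hlendB hlenB Φ
  rw [← hb] at boxH
  -- the torus dictionary: `(L^Kε)·D^ε u ↔ derivA·pullB u`, `pullB u = (L^Kε)²·greenA Φ`, `U(A(Γ)) ↔ transport`
  have keyx := smul_ofLp_covDeriv_toT_sub C j hκσ A u ⟨z, hz⟩ i hze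
  have keyx' := smul_ofLp_covDeriv_toT_sub C j hκσ A u ⟨z', hz'⟩ i hze'
  simp only at keyx keyx'
  rw [hxz, hμ, hu, Matrix.mulVec_smul] at keyx
  rw [hxz', hμ, hu, Matrix.mulVec_smul] at keyx'
  have hfs : ∀ (w : ↥(Box (dd P) (P.L - 1) K Mb) × Fin N → ℝ) (y : ↥(Box (dd P) (P.L - 1) K Mb)) (r : ℝ),
      fld (r • w) y = r • fld w y := fun w y r => rfl
  rw [hfs] at keyx keyx'
  have hhol := ofLp_holB C hK hK₀ hK₀8 hN3 hS3 j hMb hκσ A lB ⟨z, hz⟩ hxz hchB (covDeriv C A u ⟨x', μ⟩)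
  rw [hlB] at hhol
  set Wt := transport (fieldLink (flowC C) (ec / (((P.L - 1 + 1) ^ K : ℕ) : ℝ)) (bondB K K₀ j Mb σ A))
      (⟨z, hz⟩ : ↥(Box (dd P) (P.L - 1) K Mb)) lB with hWt
  set Dg := derivA (dd P) (flowC C) (ec / (((P.L - 1 + 1) ^ K : ℕ) : ℝ)) (P.L - 1) K Mb (bondB K K₀ j Mb σ A) i
      *ᵥ (greenA (dd P) (flowC C) (ec / (((P.L - 1 + 1) ^ K : ℕ) : ℝ)) (P.L - 1) K a (msq * P.mesh K ^ 2) Mb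
          (baseEmb (one_le_n P K) Mb) (gammaB P K Mb) (bondB K K₀ j Mb σ A) *ᵥ Φ) with hDg
  -- `(L^Kε)·(U(Γ)D u(x′) − D u(x))` on coordinates `= (L^Kε)²·(Wt·fld Dg z′ − fld Dg z)`
  have hcoord : WithLp.ofLp (P.mesh K • (hol C A x l (covDeriv C A u ⟨x', μ⟩) - covDeriv C A u ⟨x, μ⟩))
      = P.mesh K ^ 2 • (Wt *ᵥ fld Dg ⟨z', hz'⟩ - fld Dg ⟨z, hz⟩) := by
    rw [WithLp.ofLp_smul, WithLp.ofLp_sub, hhol, smul_sub, ← Matrix.mulVec_smul, keyx', keyx, Matrix.mulVec_smul, ← smul_sub]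
  have hnorm : P.mesh K * ‖hol C A x l (covDeriv C A u ⟨x', μ⟩) - covDeriv C A u ⟨x, μ⟩‖
      = P.mesh K ^ 2 * siteNorm (Wt *ᵥ fld Dg ⟨z', hz'⟩ - fld Dg ⟨z, hz⟩) := by
    have h1 : P.mesh K * ‖hol C A x l (covDeriv C A u ⟨x', μ⟩) - covDeriv C A u ⟨x, μ⟩‖
        = ‖P.mesh K • (hol C A x l (covDeriv C A u ⟨x', μ⟩) - covDeriv C A u ⟨x, μ⟩)‖ := by
      rw [norm_smul, Real.norm_eq_abs, abs_of_pos hmeshK]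
    rw [h1, ← siteNorm_ofLp, hcoord, siteNorm_smul, abs_of_pos (by positivity)]
  -- sizes: `supN Φ ≤ ‖φ‖`, `|z′ − z|_∞ ≤ |Γ| ≤ d|x − x′|`
  have hΦφ : supN Φ ≤ ‖φ‖ := supN_pullB_le j Mb φ
  have hsNl : supNorm (z' - z) ≤ (P.d : ℝ) * HiggsLattice.Site.tdist x x' := by
    have h1 := supNorm_pathEnd_sub_le lB ⟨z, hz⟩ hNN
    rw [hlendB] at h1
    simp only at h1
    rw [hlenB'] at h1
    exact h1.trans hlen'
  -- `siteNorm(…) ≤ C₁ (|z′−z|_∞/n)^α supN Φ`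
  have hratio : 0 < (((P.L - 1 + 1) ^ K : ℕ) : ℝ) / supNorm (z' - z) := div_pos hnr hsN0
  have hpow : 0 < ((((P.L - 1 + 1) ^ K : ℕ) : ℝ) / supNorm (z' - z)) ^ α := Real.rpow_pos_of_pos hratio α
  have hsite : siteNorm (Wt *ᵥ fld Dg ⟨z', hz'⟩ - fld Dg ⟨z, hz⟩)
      ≤ (supNorm (z' - z) / (((P.L - 1 + 1) ^ K : ℕ) : ℝ)) ^ α * (C₁ * ‖φ‖) := by
    rw [← le_div_iff₀' hpow] at boxH
    have hinv : ((supNorm (z' - z) / (((P.L - 1 + 1) ^ K : ℕ) : ℝ)) ^ α)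
        = (((((P.L - 1 + 1) ^ K : ℕ) : ℝ) / supNorm (z' - z)) ^ α)⁻¹ := by
      rw [← Real.inv_rpow hratio.le, inv_div]
    rw [hinv, ← div_eq_inv_mul]
    refine boxH.trans (div_le_div_of_nonneg_right ?_ hpow.le)
    exact mul_le_mul_of_nonneg_left hΦφ hC₁.le
  -- `(|z′−z|_∞/n)^α ≤ d·(|x−x′|/n)^α`
  have hd1' : (1 : ℝ) ≤ P.d := by exact_mod_cast P.hd
  have hfac : (supNorm (z' - z) / (((P.L - 1 + 1) ^ K : ℕ) : ℝ)) ^ α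
      ≤ (P.d : ℝ) * ((HiggsLattice.Site.tdist x x' : ℝ) / (P.L : ℝ) ^ K) ^ α := by
    rw [hnR]
    have hLK : (0 : ℝ) < (P.L : ℝ) ^ K := by rw [← hnR]; exact hnr
    calc (supNorm (z' - z) / (P.L : ℝ) ^ K) ^ α
        ≤ ((P.d : ℝ) * ((HiggsLattice.Site.tdist x x' : ℝ) / (P.L : ℝ) ^ K)) ^ α := by
          refine Real.rpow_le_rpow (div_nonneg (supNorm_nonneg _) hLK.le) ?_ hα0
          rw [← mul_div_assoc]
          exact div_le_div_of_nonneg_right hsNl hLK.le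
      _ = (P.d : ℝ) ^ α * ((HiggsLattice.Site.tdist x x' : ℝ) / (P.L : ℝ) ^ K) ^ α :=
          Real.mul_rpow (by positivity) (by positivity)
      _ ≤ (P.d : ℝ) * ((HiggsLattice.Site.tdist x x' : ℝ) / (P.L : ℝ) ^ K) ^ α := by
          refine mul_le_mul_of_nonneg_right ?_ (Real.rpow_nonneg (by positivity) _)
          calc (P.d : ℝ) ^ α ≤ (P.d : ℝ) ^ (1 : ℝ) := Real.rpow_le_rpow_of_exponent_le hd1' hα1.le
            _ = P.d := Real.rpow_one _
  -- assembly
  have hfin : P.mesh K * ‖hol C A x l (covDeriv C A u ⟨x', μ⟩) - covDeriv C A u ⟨x, μ⟩‖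
      ≤ P.mesh K * (CH * ((HiggsLattice.Site.tdist x x' : ℝ) / (P.L : ℝ) ^ K) ^ α * P.mesh K * ‖φ‖) := by
    rw [hnorm]
    calc P.mesh K ^ 2 * siteNorm (Wt *ᵥ fld Dg ⟨z', hz'⟩ - fld Dg ⟨z, hz⟩)
        ≤ P.mesh K ^ 2 * ((supNorm (z' - z) / (((P.L - 1 + 1) ^ K : ℕ) : ℝ)) ^ α * (C₁ * ‖φ‖)) :=
          mul_le_mul_of_nonneg_left hsite (by positivity)
      _ ≤ P.mesh K ^ 2 * ((P.d : ℝ) * ((HiggsLattice.Site.tdist x x' : ℝ) / (P.L : ℝ) ^ K) ^ α * (C₁ * ‖φ‖)) :=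
          mul_le_mul_of_nonneg_left (mul_le_mul_of_nonneg_right hfac (by positivity)) (by positivity)
      _ = P.mesh K * (CH * ((HiggsLattice.Site.tdist x x' : ℝ) / (P.L : ℝ) ^ K) ^ α * P.mesh K * ‖φ‖) := by
          rw [hCH_def, ← hd1]; ring
  exact le_of_mul_le_mul_left hfin hmeshK

end Inputs

end Literature.MathematicalPhysics.QuantumFieldTheory.Balaban1983to89.B1TorusSubBoxHolderInput

end
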